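/-
Origin: expansion seat `planner-pub-hodgecm-mc-theta-3-g24-0`, handover #S13 2026-08-20T18:57Z md5 0d9ecf89dd05 (441 l.; NEW additive leaf, ns HodgeCM.Model.ThetaSpace; imports Model/ThetaSpaceSat only; HECKE-TOWER theta half at FIXED level (Δ, KΓ): `KTypeSituation.satIndex` (Subgroup {c | κ c ∈ KΓ ∧ τ c = 1}), `KTypeSituation.sumFamily` (ℓ ↦ Σ_q ω((k q)⁻¹,1) (j (S.ι ℓ)), a LinearMap), `KTypeSituation.sumTranslateStrict` (the Hecke-summed situation at the SAME level: Kc = satIndex KΓ × K₁, E = W^∨, σ = τ₁^∨), `IsSaturated.sumTranslateStrict` (at the same KΓ), `IsStrict.sumFamily_act` (heart: under (hQ) `∀ a ∈ KΓ, ∃ e : Q ≃ Q, ∀ q, k (e q) * a * (k q)⁻¹ ∈ KΓ` the averaged test vectors are K-type vectors on the nose, by (E2)+(E3)+reindexing), `IsStrict.isThetaEquivariant_sumFamily`, `IsStrict.sumTranslateStrict`, `coe_thetaForm_sumTranslateStrict` (thetaForm S'' j'' f g = Σ_q thetaForm S j f (g (k q)⁻¹), tree thetaLiftFun_mul_right +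 linearity), `exists_mem_thetaForms_coe_eq_sum` (span), consumer `exists_mem_thetaSpaceSatOf_coe_eq_sum_leftTranslate` (hαk : ιinf (α q) * k q ∈ ΓU, hk, hKΓ, hQ, hcorr ⊢ F ∈ thetaSpaceSatOf P ιinf Δ κ₁ τ₁ KΓ 𝓕 → ∃ F' ∈ thetaSpaceSatOf P ιinf Δ κ₁ τ₁ KΓ 𝓕, ⇑F' = x ↦ Σ_q F (α q * x)); helpers kernelDatum_act_add/_smul/_finset_sum/_act_eq, kernelDatum_thetaLiftFun_finset_sum; + `exists_perm_forall_mul_mem_of_injective_quotient` (pure group theory: `q ↦ (k q)⁻¹KΓ` injective into `G ⧸ KΓ` with `KΓ`-left-stable image ⇒ (hQ)); NAME LIST: HodgeCM.Model.ThetaSpace.KTypeSituation.sumTranslateStrict · HodgeCM.Model.ThetaSpace.KTypeSituation.IsStrict.sumTranslateStrict · HodgeCM.Model.ThetaSpace.exists_mem_thetaSpaceSatOf_coe_eq_sum_leftTranslate) (`HOME/mc/pub-hodgecm-mc-theta-3-g24/stage/HodgeCM/Model/ThetaSpaceSatHecke.lean`, md5 0d9ecf89dd05, 441 lines);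
landed by the second packager p2 gen 12 (p2-g12) in gate run 60 as `HodgeCM/Model/ThetaSpaceSatHecke.lean` (verbatim).
-/
/-
Origin: CONSTRUCTION seat `planner-pub-hodgecm-mc-theta-3-g24-0` (unit pub-hodgecm-mc-theta-3-g24, gen 24 of mc-theta-3 — theta supply /
second-lift lane), 2026-08-20.  NEW additive leaf `HodgeCM/Model/ThetaSpaceSatHecke.lean` = OFFER (R3) of STATUS l.14117 for the
(J-Liu-Θ) junction's node HECKE-TOWER (form side of (J2)/(J4): binder-1-g15 l.14103, sinst-1-g8 l.14102): closure of the SATURATED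
classical theta spaces `thetaSpaceSatOf … KΓ …` of this lineage's `Model/ThetaSpaceSat` (gen 9) under finite sums of rational left
translates AT THE SAME LEVEL `(Δ, KΓ)` — the situation-level half (H1) of «Hecke translates of theta weight forms are theta weight
forms» at fixed level.  Imports `Model/ThetaSpaceSat` only.  KERNEL: two constructions (`KTypeSituation.satIndex`, a `Subgroup`;
`KTypeSituation.sumTranslateStrict`, a `KTypeSituation`) + one auxiliary linear map (`KTypeSituation.sumFamily`) + lemmas;
0 records, 0 `def … : Prop`, nothing cited, 0 proof holes; expected `#print axioms` ⊆ {propext, Classical.choice, Quot.sound}.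
-/
import Summits.HodgeConjecture.HodgeCM.Model.ThetaSpaceSat

/-!
# Saturated classical theta spaces under Hecke sums at fixed level (HECKE-TOWER, theta half)

`Model/ThetaSpaceTranslate` (period-1), `Model/ThetaSpaceSatTranslate` and `Model/ThetaSpaceSatRightTranslate` (this
lineage, gen 9) move ONE rational translate `x ↦ u (α x)` of a classical theta form through the adelic presentation
(`WeightForms.comp_leftTranslate_eq`: `u_F (α x) = F (ιinf x · k⁻¹)` for `ιinf α · k ∈ Γ_U`, `k` centralising `ιinf (G₁)`);
the level MOVES (`Δ ↦ Δ'`, `KΓ ↦ KΓ'`).  A Hecke operator at FIXED level is a finite SUM of such translates,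
`u ↦ (x ↦ Σ_q u (α_q x))`, whose summands are not of level `Δ` — only the sum is.  Upstairs the sum is
`Σ_q R(k_q⁻¹) F`, the theta form of the Hecke-AVERAGED test vectors `φ'' = Σ_q ω(k_q⁻¹, 1) φ`; it is again
right-`KΓ`-invariant exactly when the corrector cosets are `KΓ`-stable,

* (hQ) `∀ a ∈ KΓ, ∃ e : Q ≃ Q, ∀ q, k (e q) · a · (k q)⁻¹ ∈ KΓ`

(then `ω(a) φ'' = φ''` by (E2) `IsStrict.act_family_eq_self` and reindexing).  This file builds, for a strict situation `S`
saturated at `KΓ`, the **Hecke-summed situation** `S.sumTranslateStrict k …` AT THE SAME LEVEL `Δ` — index group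
`S.satIndex KΓ × K₁` (the index elements over `KΓ` with trivial weight, times the archimedean compact), test space `W^∨`,
families `ℓ ↦ Σ_q ω((k q)⁻¹, 1) (j (S.ι ℓ))` — and proves it saturated at `KΓ` (`IsSaturated.sumTranslateStrict`) and strict
(`IsStrict.sumTranslateStrict`, from (hQ), heart `IsStrict.sumFamily_act`); the generator identity
`coe_thetaForm_sumTranslateStrict` («`thetaForm S'' j'' f (g) = Σ_q thetaForm S j f (g (k q)⁻¹)`», tree
`thetaLiftFun_mul_right` + linearity of `thetaLiftFunₗ`) and `exists_mem_thetaForms_coe_eq_sum` (the span);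
and the consumer statement

* `exists_mem_thetaSpaceSatOf_coe_eq_sum_leftTranslate`: under (hQ), correctors `ιinf (α q) · k q ∈ Γ_U` centralising
  `ιinf (G₁)`, `KΓ` centralising `ιinf (G₁)` and `Δ`-correctors inside `KΓ` (`hcorr`, the shape of gen 9's), every
  `F ∈ thetaSpaceSatOf P ιinf Δ κ₁ τ₁ KΓ 𝓕` has `x ↦ Σ_q F (α_q x)` again in `thetaSpaceSatOf P ιinf Δ κ₁ τ₁ KΓ 𝓕`.

(hQ) and `hcorr` are carried as hypotheses (discharged pin-side by the owner of the coset dictionary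
`Γ ⁄ (Γ ∩ g⁻¹Γg) ↔ (α_q, k_q)`); the pure group-theoretic reading of (hQ) — «`q ↦ (k q)⁻¹ KΓ` is injective with
`KΓ`-stable image in `GU ⧸ KΓ`», i.e. the correctors run through a full set of left-coset representatives of a finite
union of double cosets — is recorded as `exists_perm_forall_mul_mem_of_injective_quotient`.  Nothing here knows
`Level`, `HermSpace3` or the ball.
-/

set_option autoImplicit false

noncomputable section

open MeasureTheory NumberField NumberField.mixedEmbedding IsDedekindDomain
open Literature.NumberTheory.Automorphic Literature.NumberTheory.Weil1964
open Literature.NumberTheory.Automorphic.WeightForms (restrictHom IsLevelCorrected IsWeightMatched restrictHom_apply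
  comp_leftTranslate_eq_of_mem)
open HodgeCM.PerL34.Seesaw HodgeCM.PerL34.RationalCoset HodgeCM.PerL34.SupplyAdelic
open HodgeCM.Model.SupplyInstance HodgeCM.Model.SupplyResidual

namespace HodgeCM
namespace Model
namespace ThetaSpace

/-! ## (hQ) from the coset picture -/

/-- (hQ) from the classical coset picture: if `q ↦ (k q)⁻¹ KΓ` is injective into `G ⧸ KΓ` and its image is
stable under left multiplication by `KΓ`, then every `a ∈ KΓ` permutes the index set `Q` compatibly:
`∃ e : Q ≃ Q, ∀ q, k (e q) * a * (k q)⁻¹ ∈ KΓ` — hypothesis (hQ) of `IsStrict.sumFamily_act` and of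
`exists_mem_thetaSpaceSatOf_coe_eq_sum_leftTranslate`.  Classically: the correctors `(k q)⁻¹` run through a full
set of representatives of the left `KΓ`-cosets of a finite union of double cosets `KΓ x KΓ`. -/
theorem exists_perm_forall_mul_mem_of_injective_quotient {G : Type*} [Group G] {Q : Type*} [Finite Q]
    (KΓ : Subgroup G) (k : Q → G)
    (hinj : Function.Injective fun q => (QuotientGroup.mk ((k q)⁻¹) : G ⧸ KΓ))
    (hstab : ∀ a ∈ KΓ, ∀ q, ∃ q', (QuotientGroup.mk (a * (k q)⁻¹) : G ⧸ KΓ) = QuotientGroup.mk ((k q')⁻¹)) :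
    ∀ a ∈ KΓ, ∃ e : Q ≃ Q, ∀ q, k (e q) * a * (k q)⁻¹ ∈ KΓ := by
  intro a ha
  choose f hf using hstab a ha
  have hfi : Function.Injective f := by
    intro q₁ q₂ h
    have h1 : (QuotientGroup.mk (a * (k q₁)⁻¹) : G ⧸ KΓ) = QuotientGroup.mk (a * (k q₂)⁻¹) := by
      rw [hf q₁, hf q₂, h]
    apply hinj
    rw [QuotientGroup.eq] at h1 ⊢
    simpa [mul_inv_rev, mul_assoc] using h1
  refine ⟨Equiv.ofBijective f (Finite.injective_iff_bijective.mp hfi), fun q => ?_⟩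
  have h2 := KΓ.inv_mem (QuotientGroup.eq.mp (hf q))
  simpa [mul_inv_rev, mul_assoc] using h2

section HeckeSum

variable {K L : Type} [Field K] [NumberField K] [Field L] [NumberField L] [Algebra K L] [FiniteDimensional K L]
variable {J : Type} [Fintype J] {GU : Type} [Group GU] [TopologicalSpace GU] [IsTopologicalGroup GU]
  [LocallyCompactSpace GU]
variable {P : WeilPairData K L J GU} [CompactSpace (GU ⧸ P.ΓU)]
variable {G₁ K₁ W : Type} [Group G₁] [Group K₁] [AddCommGroup W] [Module ℂ W] [Module.IsReflexive ℂ W]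
variable {ιinf : G₁ →* GU} {Δ : Subgroup G₁} {κ₁ : K₁ →* G₁} {τ₁ : Representation ℂ K₁ W}
variable {Q : Type} [Fintype Q]

/-! ### § 1. The index elements over `KΓ` with trivial weight -/

/-- **The saturation index subgroup**: the index elements `c` of `S` with `κ c ∈ KΓ` and `τ c = 1`. -/
def KTypeSituation.satIndex (S : KTypeSituation P ιinf Δ κ₁ τ₁) (KΓ : Subgroup GU) : Subgroup S.Kc where
  carrier := {c | S.κ c ∈ KΓ ∧ S.τ c = 1}
  mul_mem' := by
    rintro a b ⟨ha, hτa⟩ ⟨hb, hτb⟩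
    exact ⟨by rw [map_mul]; exact KΓ.mul_mem ha hb, by rw [map_mul, hτa, hτb, mul_one]⟩
  one_mem' := ⟨by rw [map_one]; exact KΓ.one_mem, map_one _⟩
  inv_mem' := by
    rintro a ⟨ha, hτa⟩
    refine ⟨by rw [map_inv]; exact KΓ.inv_mem ha, ?_⟩
    calc S.τ a⁻¹ = S.τ a⁻¹ * S.τ a := by rw [hτa, mul_one]
      _ = 1 := by rw [← map_mul, inv_mul_cancel, map_one]

omit [CompactSpace (GU ⧸ P.ΓU)] [Module.IsReflexive ℂ W] in
/-- (Ported verbatim from the HodgeCMPerL package; no docstring in the source.) -/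
theorem KTypeSituation.mem_satIndex_iff (S : KTypeSituation P ιinf Δ κ₁ τ₁) (KΓ : Subgroup GU) (c : S.Kc) :
    c ∈ S.satIndex KΓ ↔ S.κ c ∈ KΓ ∧ S.τ c = 1 :=
  Iff.rfl

omit [CompactSpace (GU ⧸ P.ΓU)] [Module.IsReflexive ℂ W] in
/-- An element of the saturation index subgroup maps into `KΓ`. -/
theorem KTypeSituation.coe_satIndex_mem (S : KTypeSituation P ιinf Δ κ₁ τ₁) (KΓ : Subgroup GU) (c : S.satIndex KΓ) :
    S.κ (c : S.Kc) ∈ KΓ :=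
  ((KTypeSituation.mem_satIndex_iff S KΓ (c : S.Kc)).1 c.2).1

/-! ### § 2. The Hecke-summed situation at the same level -/

omit [CompactSpace (GU ⧸ P.ΓU)] [Module.IsReflexive ℂ W] [Fintype Q] in
/-- The Weil action through the pair datum is additive (it is the representation `ω`). -/
theorem kernelDatum_act_add (x : GU × relNormOneIdeles K L) (Φ Ψ : P.weilDatum.ThetaTop) :
    P.kernelDatum.W.act (P.kernelDatum.s x) (Φ + Ψ) =
      P.kernelDatum.W.act (P.kernelDatum.s x) Φ + P.kernelDatum.W.act (P.kernelDatum.s x) Ψ := by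
  change (P.ω x : P.weilDatum.ThetaTop →ₗ[ℂ] P.weilDatum.ThetaTop) (Φ + Ψ) =
    (P.ω x : P.weilDatum.ThetaTop →ₗ[ℂ] P.weilDatum.ThetaTop) Φ + (P.ω x : P.weilDatum.ThetaTop →ₗ[ℂ] P.weilDatum.ThetaTop) Ψ
  exact map_add _ _ _

omit [CompactSpace (GU ⧸ P.ΓU)] [Module.IsReflexive ℂ W] [Fintype Q] in
/-- … and homogeneous. -/
theorem kernelDatum_act_smul (x : GU × relNormOneIdeles K L) (a : ℂ) (Φ : P.weilDatum.ThetaTop) :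
    P.kernelDatum.W.act (P.kernelDatum.s x) (a • Φ) = a • P.kernelDatum.W.act (P.kernelDatum.s x) Φ := by
  change (P.ω x : P.weilDatum.ThetaTop →ₗ[ℂ] P.weilDatum.ThetaTop) (a • Φ) =
    a • (P.ω x : P.weilDatum.ThetaTop →ₗ[ℂ] P.weilDatum.ThetaTop) Φ
  exact map_smul _ _ _

omit [CompactSpace (GU ⧸ P.ΓU)] [Module.IsReflexive ℂ W] [Fintype Q] in
/-- … hence additive over finite sums. -/
theorem kernelDatum_act_finset_sum (x : GU × relNormOneIdeles K L) (s : Finset Q) (Φ : Q → P.weilDatum.ThetaTop) :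
    P.kernelDatum.W.act (P.kernelDatum.s x) (∑ q ∈ s, Φ q) = ∑ q ∈ s, P.kernelDatum.W.act (P.kernelDatum.s x) (Φ q) := by
  change (P.ω x : P.weilDatum.ThetaTop →ₗ[ℂ] P.weilDatum.ThetaTop) (∑ q ∈ s, Φ q) =
    ∑ q ∈ s, (P.ω x : P.weilDatum.ThetaTop →ₗ[ℂ] P.weilDatum.ThetaTop) (Φ q)
  exact map_sum _ _ _

omit [CompactSpace (GU ⧸ P.ΓU)] [Module.IsReflexive ℂ W] [Fintype Q] in
/-- Two Weil actions compose: `ω(x,1) (ω(y,1) Φ) = ω(x y, 1) Φ` (`WeilPairData.kernelDatum_act_mul`). -/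
theorem kernelDatum_act_act_eq (x y : GU) (Φ : P.weilDatum.ThetaTop) :
    P.kernelDatum.W.act (P.kernelDatum.s (x, 1)) (P.kernelDatum.W.act (P.kernelDatum.s (y, 1)) Φ) =
      P.kernelDatum.W.act (P.kernelDatum.s (x * y, 1)) Φ := by
  rw [← WeilPairData.kernelDatum_act_mul, ← map_mul, Prod.mk_mul_mk, mul_one]

omit [CompactSpace (GU ⧸ P.ΓU)] [Module.IsReflexive ℂ W] in
/-- **The Hecke-averaged family** of a linear family `j` of `S`, as a linear map `W^∨ → 𝒮`:
`ℓ ↦ Σ_q ω((k q)⁻¹, 1) (j (S.ι ℓ))`. -/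
def KTypeSituation.sumFamily (S : KTypeSituation P ιinf Δ κ₁ τ₁) (k : Q → GU)
    (j : S.E →ₗ[ℂ] P.weilDatum.ThetaTop) : Module.Dual ℂ W →ₗ[ℂ] P.weilDatum.ThetaTop where
  toFun ℓ := ∑ q, P.kernelDatum.W.act (P.kernelDatum.s ((k q)⁻¹, 1)) (j (S.ι ℓ))
  map_add' ℓ ℓ' := by
    rw [← Finset.sum_add_distrib]
    exact Finset.sum_congr rfl fun q _ => by rw [map_add, map_add, kernelDatum_act_add]
  map_smul' a ℓ := by
    rw [RingHom.id_apply, Finset.smul_sum]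
    exact Finset.sum_congr rfl fun q _ => by rw [map_smul, map_smul, kernelDatum_act_smul]

omit [CompactSpace (GU ⧸ P.ΓU)] [Module.IsReflexive ℂ W] in
/-- (Ported verbatim from the HodgeCMPerL package; no docstring in the source.) -/
theorem KTypeSituation.sumFamily_apply (S : KTypeSituation P ιinf Δ κ₁ τ₁) (k : Q → GU)
    (j : S.E →ₗ[ℂ] P.weilDatum.ThetaTop) (ℓ : Module.Dual ℂ W) :
    S.sumFamily k j ℓ = ∑ q, P.kernelDatum.W.act (P.kernelDatum.s ((k q)⁻¹, 1)) (j (S.ι ℓ)) :=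
  rfl

/-- **The Hecke-summed situation** of `S` for the finite family `k : Q → G_U(𝔸)`: index group `S.satIndex KΓ × K₁` mapped by
`(c, u) ↦ κ c · ιinf (κ₁ u)`, weight `τ₁` through the second factor, test space `W^∨` with `σ = τ₁^∨`, families the
Hecke-averaged families `S.sumFamily k j` (`j ∈ S.𝓙`, characterised pointwise); SAME level `Δ` (correctors in `KΓ`
from `hcorr`, read through the saturation of `S`).  Its families are theta-equivariant under (hQ)
(`IsStrict.isThetaEquivariant_sumFamily`); without (hQ) the family set may be empty. -/
def KTypeSituation.sumTranslateStrict (S : KTypeSituation P ιinf Δ κ₁ τ₁) (k : Q → GU) {KΓ : Subgroup GU}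
    (hS : S.IsSaturated KΓ) (hKΓ : ∀ a ∈ KΓ, ∀ x : G₁, Commute a (ιinf x))
    (hcorr : ∀ δ ∈ Δ, ∃ x ∈ KΓ, ιinf δ * x ∈ P.ΓU ∧ ∀ y : G₁, Commute x (ιinf y)) :
    KTypeSituation P ιinf Δ κ₁ τ₁ where
  Kc := S.satIndex KΓ × K₁
  κ := (S.κ.comp (S.satIndex KΓ).subtype).noncommCoprod (ιinf.comp κ₁)
    fun c u => hKΓ _ (S.coe_satIndex_mem KΓ c) (κ₁ u)
  E := Module.Dual ℂ W
  σ := Representation.dual (τ₁.comp (MonoidHom.snd (S.satIndex KΓ) K₁))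
  τ := τ₁.comp (MonoidHom.snd (S.satIndex KΓ) K₁)
  ι := LinearMap.id
  hι := fun _ _ => rfl
  η₁ := MonoidHom.inr (S.satIndex KΓ) K₁
  hΔ := by
    intro δ hδ
    obtain ⟨x, hxK, hxΓ, hxc⟩ := hcorr δ hδ
    obtain ⟨c, hc, hτ⟩ := hS x hxK
    have hcK : c ∈ S.satIndex KΓ := (KTypeSituation.mem_satIndex_iff S KΓ c).2 ⟨hc ▸ hxK, hτ⟩
    refine ⟨(⟨c, hcK⟩, 1), ?_, ?_, fun y => ?_⟩
    · show τ₁ (1 : K₁) = 1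
      exact map_one τ₁
    · show ιinf δ * (S.κ c * ιinf (κ₁ 1)) ∈ P.ΓU
      rw [map_one, map_one, mul_one, hc]
      exact hxΓ
    · show Commute (S.κ c * ιinf (κ₁ 1)) (ιinf y)
      rw [map_one, map_one, mul_one, hc]
      exact hxc y
  hη := ⟨fun u => show S.κ ((1 : S.satIndex KΓ) : S.Kc) * ιinf (κ₁ u) = ιinf (κ₁ u) by
      rw [OneMemClass.coe_one, map_one, one_mul],
    fun _ => rfl⟩
  𝓙 := {j' | ∃ j ∈ S.𝓙, ∀ ℓ : Module.Dual ℂ W,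
    j'.1 ℓ = ∑ q, P.kernelDatum.W.act (P.kernelDatum.s ((k q)⁻¹, 1)) (j.1 (S.ι ℓ))}

omit [CompactSpace (GU ⧸ P.ΓU)] [Module.IsReflexive ℂ W] in
/-- The index map of the summed situation on points: `κ'' (c, u) = κ c · ιinf (κ₁ u)`. -/
theorem KTypeSituation.sumTranslateStrict_κ_mk (S : KTypeSituation P ιinf Δ κ₁ τ₁) (k : Q → GU) {KΓ : Subgroup GU}
    (hS : S.IsSaturated KΓ) (hKΓ : ∀ a ∈ KΓ, ∀ x : G₁, Commute a (ιinf x))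
    (hcorr : ∀ δ ∈ Δ, ∃ x ∈ KΓ, ιinf δ * x ∈ P.ΓU ∧ ∀ y : G₁, Commute x (ιinf y))
    (c : S.satIndex KΓ) (u : K₁) :
    (S.sumTranslateStrict k hS hKΓ hcorr).κ (c, u) = S.κ (c : S.Kc) * ιinf (κ₁ u) :=
  rfl

omit [CompactSpace (GU ⧸ P.ΓU)] [Module.IsReflexive ℂ W] in
/-- The `K`-type action of the summed situation on its test space `W^∨` on points: `σ'' (c, u) ℓ = τ₁^∨ (u) ℓ`. -/
theorem KTypeSituation.sumTranslateStrict_σ_mk (S : KTypeSituation P ιinf Δ κ₁ τ₁) (k : Q → GU) {KΓ : Subgroup GU}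
    (hS : S.IsSaturated KΓ) (hKΓ : ∀ a ∈ KΓ, ∀ x : G₁, Commute a (ιinf x))
    (hcorr : ∀ δ ∈ Δ, ∃ x ∈ KΓ, ιinf δ * x ∈ P.ΓU ∧ ∀ y : G₁, Commute x (ιinf y))
    (c : S.satIndex KΓ) (u : K₁) (ℓ : Module.Dual ℂ W) :
    (S.sumTranslateStrict k hS hKΓ hcorr).σ (c, u) ℓ = τ₁.dual u ℓ :=
  rfl

omit [CompactSpace (GU ⧸ P.ΓU)] [Module.IsReflexive ℂ W] in
/-- The test map of the summed situation is the identity of `W^∨`. -/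
theorem KTypeSituation.sumTranslateStrict_ι_apply (S : KTypeSituation P ιinf Δ κ₁ τ₁) (k : Q → GU) {KΓ : Subgroup GU}
    (hS : S.IsSaturated KΓ) (hKΓ : ∀ a ∈ KΓ, ∀ x : G₁, Commute a (ιinf x))
    (hcorr : ∀ δ ∈ Δ, ∃ x ∈ KΓ, ιinf δ * x ∈ P.ΓU ∧ ∀ y : G₁, Commute x (ιinf y)) (ℓ : Module.Dual ℂ W) :
    (S.sumTranslateStrict k hS hKΓ hcorr).ι ℓ = ℓ :=
  rfl

omit [CompactSpace (GU ⧸ P.ΓU)] [Module.IsReflexive ℂ W] in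
/-- **Saturation at the SAME `KΓ`**: every `a ∈ KΓ` is `κ'' (c, 1)` with `c` the index element of `S` over `a` of trivial
weight. -/
theorem KTypeSituation.IsSaturated.sumTranslateStrict {S : KTypeSituation P ιinf Δ κ₁ τ₁} (k : Q → GU) {KΓ : Subgroup GU}
    (hS : S.IsSaturated KΓ) (hKΓ : ∀ a ∈ KΓ, ∀ x : G₁, Commute a (ιinf x))
    (hcorr : ∀ δ ∈ Δ, ∃ x ∈ KΓ, ιinf δ * x ∈ P.ΓU ∧ ∀ y : G₁, Commute x (ιinf y)) :
    (S.sumTranslateStrict k hS hKΓ hcorr).IsSaturated KΓ := by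
  intro a ha
  obtain ⟨c, hc, hτ⟩ := hS a ha
  have hcK : c ∈ S.satIndex KΓ := (KTypeSituation.mem_satIndex_iff S KΓ c).2 ⟨hc ▸ ha, hτ⟩
  refine ⟨(⟨c, hcK⟩, 1), ?_, ?_⟩
  · show S.κ c * ιinf (κ₁ 1) = a
    rw [map_one, map_one, mul_one, hc]
  · show τ₁ (1 : K₁) = 1
    exact map_one τ₁

/-! ### § 3. The Hecke-averaged test vectors are `K`-type vectors on the nose (from (hQ)) -/

omit [CompactSpace (GU ⧸ P.ΓU)] [Module.IsReflexive ℂ W] in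
/-- **The heart**: in a strict situation saturated at `KΓ`, under (hQ) the Hecke-averaged test vectors
`φ''^ℓ = Σ_q ω((k q)⁻¹, 1) φ^ℓ` transform ON THE NOSE under `KΓ · ιinf (κ₁ K₁)`:
`φ''^{τ₁^∨(u) ℓ} = ω(a · ιinf (κ₁ u), 1) φ''^ℓ` for `a ∈ KΓ` — `a` permutes the summands up to `KΓ`, which fixes `φ^ℓ` by (E2). -/
theorem KTypeSituation.IsStrict.sumFamily_act {S : KTypeSituation P ιinf Δ κ₁ τ₁} (hstr : S.IsStrict)
    {KΓ : Subgroup GU} (hS : S.IsSaturated KΓ) (k : Q → GU) (hk : ∀ q (x : G₁), Commute (k q) (ιinf x))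
    (hKΓ : ∀ a ∈ KΓ, ∀ x : G₁, Commute a (ιinf x))
    (hQ : ∀ a ∈ KΓ, ∃ e : Q ≃ Q, ∀ q, k (e q) * a * (k q)⁻¹ ∈ KΓ)
    {j : {j : S.E →ₗ[ℂ] P.weilDatum.ThetaTop // P.kernelDatum.IsThetaEquivariant S.κ S.σ j}} (hj : j ∈ S.𝓙)
    {a : GU} (ha : a ∈ KΓ) (u : K₁) (ℓ : Module.Dual ℂ W) :
    ∑ q, P.kernelDatum.W.act (P.kernelDatum.s ((k q)⁻¹, 1)) (j.1 (S.ι (τ₁.dual u ℓ))) =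
      P.kernelDatum.W.act (P.kernelDatum.s (a * ιinf (κ₁ u), 1))
        (∑ q, P.kernelDatum.W.act (P.kernelDatum.s ((k q)⁻¹, 1)) (j.1 (S.ι ℓ))) := by
  obtain ⟨e, he⟩ := hQ a ha
  have hL : ∀ q, P.kernelDatum.W.act (P.kernelDatum.s ((k q)⁻¹, 1)) (j.1 (S.ι (τ₁.dual u ℓ))) =
      P.kernelDatum.W.act (P.kernelDatum.s (ιinf (κ₁ u) * (k q)⁻¹, 1)) (j.1 (S.ι ℓ)) := by
    intro q
    rw [← hstr.act_family_arch hj u ℓ, kernelDatum_act_act_eq, ((hk q (κ₁ u)).inv_left).eq]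
  have hR : ∀ q, P.kernelDatum.W.act (P.kernelDatum.s (a * ιinf (κ₁ u), 1))
      (P.kernelDatum.W.act (P.kernelDatum.s ((k q)⁻¹, 1)) (j.1 (S.ι ℓ))) =
      P.kernelDatum.W.act (P.kernelDatum.s (ιinf (κ₁ u) * (k (e q))⁻¹, 1)) (j.1 (S.ι ℓ)) := by
    intro q
    have key : a * ιinf (κ₁ u) * (k q)⁻¹ = (ιinf (κ₁ u) * (k (e q))⁻¹) * (k (e q) * a * (k q)⁻¹) := by
      rw [(hKΓ a ha (κ₁ u)).eq]; group
    rw [kernelDatum_act_act_eq, key, ← kernelDatum_act_act_eq, hstr.act_family_eq_self hS hj (he q) ℓ]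
  rw [Finset.sum_congr rfl fun q _ => hL q, kernelDatum_act_finset_sum, Finset.sum_congr rfl fun q _ => hR q]
  exact (Equiv.sum_comp e (fun q => P.kernelDatum.W.act (P.kernelDatum.s (ιinf (κ₁ u) * (k q)⁻¹, 1)) (j.1 (S.ι ℓ)))).symm

omit [CompactSpace (GU ⧸ P.ΓU)] [Module.IsReflexive ℂ W] in
/-- Under (hQ) the Hecke-averaged family of a family of `S` is theta-equivariant for the summed situation (indeed a
`K`-type vector on the nose, `sumFamily_act`). -/
theorem KTypeSituation.IsStrict.isThetaEquivariant_sumFamily {S : KTypeSituation P ιinf Δ κ₁ τ₁} (hstr : S.IsStrict)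
    {KΓ : Subgroup GU} (hS : S.IsSaturated KΓ) (k : Q → GU) (hk : ∀ q (x : G₁), Commute (k q) (ιinf x))
    (hKΓ : ∀ a ∈ KΓ, ∀ x : G₁, Commute a (ιinf x))
    (hQ : ∀ a ∈ KΓ, ∃ e : Q ≃ Q, ∀ q, k (e q) * a * (k q)⁻¹ ∈ KΓ)
    (hcorr : ∀ δ ∈ Δ, ∃ x ∈ KΓ, ιinf δ * x ∈ P.ΓU ∧ ∀ y : G₁, Commute x (ιinf y))
    {j : {j : S.E →ₗ[ℂ] P.weilDatum.ThetaTop // P.kernelDatum.IsThetaEquivariant S.κ S.σ j}} (hj : j ∈ S.𝓙) :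
    P.kernelDatum.IsThetaEquivariant (S.sumTranslateStrict k hS hKΓ hcorr).κ (S.sumTranslateStrict k hS hKΓ hcorr).σ
      (S.sumFamily k j.1) := by
  refine P.kernelDatum.isThetaEquivariant_of_act fun c ℓ' => ?_
  obtain ⟨c, u⟩ := c
  rw [S.sumTranslateStrict_κ_mk k hS hKΓ hcorr c u, S.sumTranslateStrict_σ_mk k hS hKΓ hcorr c u ℓ']
  -- `S.sumFamily k j.1 x` is the sum by `rfl`; `exact` compares up to unfolding (no syntactic instance match on `𝒮`)
  exact hstr.sumFamily_act hS k hk hKΓ hQ hj (S.coe_satIndex_mem KΓ c) u ℓ'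

omit [CompactSpace (GU ⧸ P.ΓU)] [Module.IsReflexive ℂ W] in
/-- **Strictness of the summed situation** (from (hQ)): its families are `K`-type vectors on the nose. -/
theorem KTypeSituation.IsStrict.sumTranslateStrict {S : KTypeSituation P ιinf Δ κ₁ τ₁} (hstr : S.IsStrict)
    {KΓ : Subgroup GU} (hS : S.IsSaturated KΓ) (k : Q → GU) (hk : ∀ q (x : G₁), Commute (k q) (ιinf x))
    (hKΓ : ∀ a ∈ KΓ, ∀ x : G₁, Commute a (ιinf x))
    (hQ : ∀ a ∈ KΓ, ∃ e : Q ≃ Q, ∀ q, k (e q) * a * (k q)⁻¹ ∈ KΓ)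
    (hcorr : ∀ δ ∈ Δ, ∃ x ∈ KΓ, ιinf δ * x ∈ P.ΓU ∧ ∀ y : G₁, Commute x (ιinf y)) :
    (S.sumTranslateStrict k hS hKΓ hcorr).IsStrict := by
  rintro j' ⟨j, hj, hje⟩ ⟨c, u⟩ ℓ'
  have hje' : ∀ ℓ : Module.Dual ℂ W,
      j'.1 ℓ = ∑ q, P.kernelDatum.W.act (P.kernelDatum.s ((k q)⁻¹, 1)) (j.1 (S.ι ℓ)) := hje
  rw [S.sumTranslateStrict_κ_mk k hS hKΓ hcorr c u, S.sumTranslateStrict_σ_mk k hS hKΓ hcorr c u ℓ',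
    hje' (τ₁.dual u ℓ'), hje' ℓ']
  exact hstr.sumFamily_act hS k hk hKΓ hQ hj (S.coe_satIndex_mem KΓ c) u ℓ'

/-! ### § 4. Theta forms of the summed situation are the Hecke sums of those of `S` -/

omit [Fintype Q] in
/-- The theta lift is additive over finite sums in the Schwartz variable (linearity of the tree's `thetaLiftFunₗ`,
unrolled by induction so that no instance path on the synonym `𝒮 = ThetaTop` is compared syntactically). -/
theorem kernelDatum_thetaLiftFun_finset_sum (s : Finset Q) (Φ : Q → P.weilDatum.ThetaTop)
    (f : C(relNormOneIdeles K L ⧸ relNormOneRat K L, ℂ)) (g : GU) :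
    P.kernelDatum.thetaLiftFun (probHaarRelNormOneQuot K L) (∑ q ∈ s, Φ q) f g =
      ∑ q ∈ s, P.kernelDatum.thetaLiftFun (probHaarRelNormOneQuot K L) (Φ q) f g := by
  induction s using Finset.cons_induction with
  | empty =>
      rw [Finset.sum_empty, Finset.sum_empty]
      exact congrFun (P.kernelDatum.thetaLiftFunₗ (probHaarRelNormOneQuot K L) P.kernelDatum_thetaLinear f).map_zero g
  | cons a s ha ih =>
      rw [Finset.sum_cons, Finset.sum_cons, ← ih]
      exact congrFun ((P.kernelDatum.thetaLiftFunₗ (probHaarRelNormOneQuot K L) P.kernelDatum_thetaLinear f).map_add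
        (Φ a) (∑ q ∈ s, Φ q)) g

/-- **Generator identity**: for a family `j''` of the summed situation with `j'' ℓ = Σ_q ω((k q)⁻¹, 1) (j (S.ι ℓ))`
pointwise, its theta form is `g ↦ Σ_q (thetaForm S j f) (g (k q)⁻¹)` (tree `thetaLiftFun_mul_right` and the
linearity of `thetaLiftFunₗ`, read through `W^∨`, which separates points). -/
theorem KTypeSituation.coe_thetaForm_sumTranslateStrict (S : KTypeSituation P ιinf Δ κ₁ τ₁) (k : Q → GU)
    {KΓ : Subgroup GU} (hS : S.IsSaturated KΓ) (hKΓ : ∀ a ∈ KΓ, ∀ x : G₁, Commute a (ιinf x))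
    (hcorr : ∀ δ ∈ Δ, ∃ x ∈ KΓ, ιinf δ * x ∈ P.ΓU ∧ ∀ y : G₁, Commute x (ιinf y))
    {j : {j : S.E →ₗ[ℂ] P.weilDatum.ThetaTop // P.kernelDatum.IsThetaEquivariant S.κ S.σ j}}
    {j' : {j' : (S.sumTranslateStrict k hS hKΓ hcorr).E →ₗ[ℂ] P.weilDatum.ThetaTop //
      P.kernelDatum.IsThetaEquivariant (S.sumTranslateStrict k hS hKΓ hcorr).κ (S.sumTranslateStrict k hS hKΓ hcorr).σ j'}}
    (hje : ∀ ℓ : Module.Dual ℂ W,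
      j'.1 ℓ = ∑ q, P.kernelDatum.W.act (P.kernelDatum.s ((k q)⁻¹, 1)) (j.1 (S.ι ℓ)))
    (f : C(relNormOneIdeles K L ⧸ relNormOneRat K L, ℂ)) :
    ((P.kernelDatum.thetaForm (probHaarRelNormOneQuot K L) P.kernelDatum_thetaLinear
        (S.sumTranslateStrict k hS hKΓ hcorr).κ j'.1 j'.2 (S.sumTranslateStrict k hS hKΓ hcorr).ι
        (S.sumTranslateStrict k hS hKΓ hcorr).hι f).1 : GU → W) =
      fun g => ∑ q, (P.kernelDatum.thetaForm (probHaarRelNormOneQuot K L) P.kernelDatum_thetaLinear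
        S.κ j.1 j.2 S.ι S.hι f).1 (g * (k q)⁻¹) := by
  funext g
  refine WeightForms.eq_of_forall_dual_eq (R := ℂ) fun ℓ => ?_
  simp only [map_sum, ThetaKernelDatum.apply_thetaForm]
  -- `S''.ι ℓ = ℓ` by `rfl`; move `hje ℓ` in by transitivity (defeq, not syntactic, on the synonym `𝒮`)
  refine (congrArg (fun Φ => P.kernelDatum.thetaLiftFun (probHaarRelNormOneQuot K L) Φ f g) (hje ℓ)).trans ?_
  rw [kernelDatum_thetaLiftFun_finset_sum]
  refine Finset.sum_congr rfl fun q _ => ?_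
  exact (P.kernelDatum.thetaLiftFun_mul_right (probHaarRelNormOneQuot K L) (j.1 (S.ι ℓ)) f g (k q)⁻¹).symm


-- port_pkg: scope closed for this part
end HeckeSum
end ThetaSpace
end Model
end HodgeCM
end
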